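import Mathlib
import Literature.Analysis.FluidPDE.VectorCalculus
import Literature.Analysis.FluidPDE.VorticityCalculus
import Literature.Analysis.FluidPDE.WholeSpaceIBP
import Summits.NavierStokesRegularity.NavierStokesRegularity.Theorems.AffineBernoulliAlignedStratumTrivialZeros
import Summits.NavierStokesRegularity.NavierStokesRegularity.Theorems.AffineBernoulliAlignedStratumTrivialFields
import Summits.NavierStokesRegularity.NavierStokesRegularity.Theorems.AffineBernoulliAlignedStratumTrivialCutoff
import Summits.NavierStokesRegularity.NavierStokesRegularity.Theorems.AffineBernoulliAlignedStratumTrivialTools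
import Summits.NavierStokesRegularity.NavierStokesRegularity.Theorems.AffineBernoulliAlignedStratumTrivialStep1
import HarnessLib

/-!
# `AffineBernoulli.AlignedStratumTrivial` — Step 2: the aligned vorticity vanishes everywhere
  (route `AffineBernoulli`, item stmt-NavierStokesRegularity-13663, helper file VII)

`AlignedStratum.ratio_eq_zero`: for `W ∈ C²` divergence free with `‖W y‖ ≤ C(1+‖y‖)⁻¹` and
`curl W × V ≡ 0` (`V y = ½(y − c) + W y`), the ratio `λ = ⟪curl W, V⟫/‖V‖²` vanishes at EVERY
point with `V ≠ 0`; hence `curl W ≡ 0` (`AlignedStratum.curl_eq_zero`, using the zero-set lemma on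
`{V = 0}`).
PROOF. Far points are Step 1. If `λ(y₀) ≠ 0` with `dist y₀ c ≤ ρ₀`, integrate
`F = D(ĝη_ε)[G₂] + ĝ η_ε div G₂` (`∫ F = 0`, helper V) with a bump `ĝ = 1` on `closedBall c (ρ₀+1)`,
the cutoff `η_ε` of `K = {V = 0} ∩ closedBall c (ρ₀+2)` (helper III) and `G₂ = (λ²+δ²)^{1/4} V`
(helper II): pointwise `F ≥ κ₂ 𝟙_{B(y₀,r)} − 4MA 𝟙_{S_ε} − √δ D 𝟙_{closedBall}` (the outer term lives
where `λ = 0` by Step 1, so it is `O(√δ)`), and small `δ`, `ε` give a positive integral.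

HONEST FRAMING: a Liouville-type lemma about HYPOTHETICAL self-similar Euler profiles; nothing here
bears on the regularity problem itself.
-/

noncomputable section

set_option linter.dupNamespace false

namespace Summit.NavierStokesRegularity.NavierStokesRegularity.Theorems

open Set Function Filter Topology InnerProductSpace MeasureTheory Metric
open scoped RealInnerProductSpace
open Literature.Analysis.FluidPDE

namespace AlignedStratum

/-- **Step 2 (everywhere off the zero set).** Under `W ∈ C²`, `div W = 0`, `‖W y‖ ≤ C(1+‖y‖)⁻¹` and
alignment, `⟪curl W y₀, V y₀⟫/‖V y₀‖² = 0` at every `y₀` with `V y₀ = ½(y₀−c) + W y₀ ≠ 0`. -/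
theorem ratio_eq_zero {W : EuclideanSpace ℝ (Fin 3) → EuclideanSpace ℝ (Fin 3)}
    {c : EuclideanSpace ℝ (Fin 3)} {C : ℝ} (hW : ContDiff ℝ 2 W)
    (hdiv : VectorCalculus.IsDivFree W) (hWC : ∀ y, ‖W y‖ ≤ C * (1 + ‖y‖)⁻¹)
    (halign : ∀ y, cross (curl W y) ((1 / 2 : ℝ) • (y - c) + W y) = 0)
    {y₀ : EuclideanSpace ℝ (Fin 3)} (hVy₀ : (1 / 2 : ℝ) • (y₀ - c) + W y₀ ≠ 0) :
    ⟪curl W y₀, (1 / 2 : ℝ) • (y₀ - c) + W y₀⟫ / ‖(1 / 2 : ℝ) • (y₀ - c) + W y₀‖ ^ 2 = 0 := by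
  set V : EuclideanSpace ℝ (Fin 3) → EuclideanSpace ℝ (Fin 3) :=
    fun y => (1 / 2 : ℝ) • (y - c) + W y with hVdef
  set lam : EuclideanSpace ℝ (Fin 3) → ℝ := fun y => ⟪curl W y, V y⟫ / ‖V y‖ ^ 2 with hlamdef
  set ρ₀ : ℝ := √(2 * (C * (1 + ‖c‖))) + 1 with hρ₀
  show lam y₀ = 0
  by_cases hfar₀ : ρ₀ < dist y₀ c
  · exact ratio_eq_zero_of_far hW hdiv hWC halign hfar₀
  rw [not_lt] at hfar₀
  by_contra hne
  obtain ⟨hC0, hWb⟩ := decay_consts hWC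
  have hWd : Differentiable ℝ W := hW.differentiable (by norm_num)
  have hV2 : ContDiff ℝ 2 V := contDiff_simField hW
  have hV1 : ContDiff ℝ 1 V := hV2.of_le (by norm_num)
  have hVc : Continuous V := hV2.continuous
  have hρ₀pos : 0 < ρ₀ := by positivity
  have hfarne : ∀ y, ρ₀ ≤ dist y c → V y ≠ 0 := by
    intro y hy hV0
    have h12 : 1 / 2 ≤ ⟪y - c, V y⟫ := half_le_inner_simField hC0 hWC hy
    rw [hV0, inner_zero_right] at h12
    linarith
  have hlamU : ∀ y, V y ≠ 0 → ContDiffAt ℝ 1 lam y := fun y hy => contDiffAt_ratio hW hy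
  have hcurlU : ∀ y, V y ≠ 0 → curl W y = lam y • V y := fun y hy => curl_eq_ratio_smul (halign y) hy
  have htrU : ∀ y, V y ≠ 0 → fderiv ℝ lam y (V y) = -(3 / 2) * lam y :=
    fun y hy => fderiv_ratio_apply_simField hW hdiv halign hy
  have hdivV : ∀ y, VectorCalculus.divergence V y = 3 / 2 := fun y => divergence_simField hWd hdiv y
  have hfarlam : ∀ y, ρ₀ < dist y c → lam y = 0 := fun y hy => ratio_eq_zero_of_far hW hdiv hWC halign hy
  -- the bump `ĝ`: `= 1` on `closedBall c Rg`, supported in `ball c R₁`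
  set Rg : ℝ := ρ₀ + 1 with hRg
  set R₁ : ℝ := ρ₀ + 2 with hR₁
  let bg : ContDiffBump c := ⟨Rg, R₁, by positivity, by rw [hRg, hR₁]; linarith⟩
  set g : EuclideanSpace ℝ (Fin 3) → ℝ := fun y => bg y with hgdef
  have hg1 : ContDiff ℝ 1 g := bg.contDiff
  have hg01 : ∀ y, 0 ≤ g y ∧ g y ≤ 1 := fun y => ⟨bg.nonneg, bg.le_one⟩
  have hgc : HasCompactSupport g := bg.hasCompactSupport
  have hgR : ∀ y, R₁ < dist y c → g y = 0 := fun y hy => bg.zero_of_le_dist hy.le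
  have hgone : ∀ y, dist y c ≤ Rg → g y = 1 := fun y hy => bg.one_of_mem_closedBall (mem_closedBall.2 hy)
  obtain ⟨Cg, hCg⟩ := (hg1.continuous_fderiv one_ne_zero).bounded_above_of_compact_support
    (hgc.fderiv (𝕜 := ℝ))
  have hCg0 : 0 ≤ Cg := (norm_nonneg _).trans (hCg c)
  have hgD0 : ∀ y, dist y c < Rg → fderiv ℝ g y = 0 := by
    intro y hy
    have hev : g =ᶠ[𝓝 y] fun _ => (1 : ℝ) := by
      filter_upwards [Metric.isOpen_ball.mem_nhds (mem_ball.2 hy)] with z hz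
      exact hgone z (mem_ball.1 hz).le
    rw [hev.fderiv_eq, fderiv_const_apply]
  have hgD1 : ∀ y, R₁ < dist y c → fderiv ℝ g y = 0 := by
    intro y hy
    refine fderiv_of_notMem_tsupport ℝ ?_
    rw [hgdef, bg.tsupport_eq]
    exact fun h => not_le.2 hy (mem_closedBall.1 h)
  -- the zero set inside the big ball
  set K : Set (EuclideanSpace ℝ (Fin 3)) := {y | V y = 0 ∧ dist y c ≤ R₁} with hKdef
  have hKc : IsCompact K := by
    have hcl : IsClosed {y : EuclideanSpace ℝ (Fin 3) | V y = 0} := isClosed_eq hVc continuous_const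
    have : K = {y | V y = 0} ∩ closedBall c R₁ := by
      ext y; simp [hKdef, mem_closedBall]
    rw [this]
    exact (isCompact_closedBall c R₁).inter_left hcl
  have hKρ : ∀ k ∈ K, dist k c < ρ₀ := by
    intro k hk
    by_contra h
    exact hfarne k (not_lt.1 h) hk.1
  have hKzero : ∀ k ∈ K, (1 / 2 : ℝ) • (k - c) + W k = 0 ∧ curl W k = 0 :=
    fun k hk => ⟨hk.1, curl_eq_zero_of_simField_eq_zero hW halign hk.1⟩
  obtain ⟨L, hL0, hL⟩ := exists_lipschitz_const hW c R₁
  have hLin : ∀ y, dist y c ≤ R₁ → 0 < infDist y K →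
      ‖curl W y‖ ≤ L * infDist y K ∧ ‖V y‖ ≤ L * infDist y K := fun y hy hpos =>
    norm_le_mul_infDist hKc (fun k hk => hk.2) hKzero hL hy hpos
  obtain ⟨CV, hCV⟩ := (isCompact_closedBall c R₁).exists_bound_of_continuousOn hVc.continuousOn
  have hCV0 : 0 ≤ CV := (norm_nonneg _).trans (hCV c (mem_closedBall_self (by positivity)))
  set m : ℝ := |lam y₀| / 2 with hmdef
  have hm : 0 < m := by have := abs_pos.2 hne; positivity
  clear_value m
  have hlamc : ContinuousAt lam y₀ := (hlamU y₀ hVy₀).continuousAt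
  obtain ⟨r₁, hr₁, hr₁b⟩ := Metric.continuousAt_iff.1 hlamc m hm
  have hy₀K : y₀ ∉ K := fun h => hVy₀ h.1
  obtain ⟨r₂, hr₂, hr₂b⟩ : ∃ r₂ > 0, ∀ k ∈ K, r₂ ≤ dist y₀ k := by
    rcases K.eq_empty_or_nonempty with hK | hK
    · exact ⟨1, one_pos, fun k hk => by rw [hK] at hk; exact absurd hk (notMem_empty k)⟩
    · exact ⟨infDist y₀ K, (hKc.isClosed.notMem_iff_infDist_pos hK).1 hy₀K,
        fun k hk => infDist_le_dist_of_mem hk⟩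
  set r : ℝ := min (min r₁ (r₂ / 2)) (1 / 2) with hrdef
  have hr : 0 < r := by positivity
  have hrr₁ : r ≤ r₁ := (min_le_left _ _).trans (min_le_left _ _)
  have hrr₂ : r ≤ r₂ / 2 := (min_le_left _ _).trans (min_le_right _ _)
  have hrh : r ≤ 1 / 2 := min_le_right _ _
  clear_value r
  have hball : ∀ y, dist y y₀ < r → m ≤ |lam y| ∧ dist y c < Rg ∧ ∀ k ∈ K, r₂ / 2 < dist y k := by
    intro y hy
    refine ⟨?_, ?_, fun k hk => ?_⟩
    · have := hr₁b (lt_of_lt_of_le hy hrr₁)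
      rw [Real.dist_eq] at this
      have h1 : |lam y₀| - |lam y| ≤ |lam y - lam y₀| := by
        have := abs_sub_abs_le_abs_sub (lam y₀) (lam y); rwa [abs_sub_comm] at this
      rw [hmdef]; linarith
    · have := dist_triangle y y₀ c
      rw [hRg]; linarith
    · have := dist_triangle y₀ y k
      have h2 := hr₂b k hk
      rw [dist_comm y₀ y] at this
      linarith
  have hballV : ∀ y, dist y y₀ < r → V y ≠ 0 := by
    intro y hy hVy
    have hyK : y ∈ K := ⟨hVy, by rw [hR₁]; linarith [(hball y hy).2.1]⟩
    have := (hball y hy).2.2 y hyK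
    rw [dist_self] at this
    linarith
  obtain ⟨M, hM0, hcut⟩ := exists_cutoff K
  set A : ℝ := L + L with hAdef
  have hA0 : 0 ≤ A := by positivity
  clear_value A
  set κ₂ : ℝ := 3 / 4 * √m with hκ₂
  have hκ₂0 : 0 < κ₂ := by positivity
  clear_value κ₂
  obtain ⟨vb, hvb⟩ : ∃ vb : ℝ, vb = (volume (ball y₀ r)).toReal := ⟨_, rfl⟩
  have hvb0 : 0 < vb := by
    rw [hvb]; exact ENNReal.toReal_pos (measure_ball_pos volume y₀ hr).ne' measure_ball_lt_top.ne
  obtain ⟨vB, hvB⟩ : ∃ vB : ℝ, vB = (volume (closedBall c R₁)).toReal := ⟨_, rfl⟩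
  have hvB0 : 0 ≤ vB := by rw [hvB]; exact ENNReal.toReal_nonneg
  set D : ℝ := Cg * CV with hDdef
  have hD0 : 0 ≤ D := by positivity
  clear_value D
  -- choice of `δ`: `√δ · D · vB ≤ κ₂ vb / 4`, `δ ≤ 1`
  set δ : ℝ := min 1 ((κ₂ * vb / (4 * (D * vB + 1))) ^ 2) with hδdef
  have hδ0 : 0 < δ := by positivity
  have hδ1 : δ ≤ 1 := min_le_left _ _
  have hδD : √δ * (D * vB) ≤ κ₂ * vb / 4 := by
    have h1 : √δ ≤ κ₂ * vb / (4 * (D * vB + 1)) := by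
      rw [Real.sqrt_le_left (by positivity)]
      exact min_le_right _ _
    calc √δ * (D * vB) ≤ κ₂ * vb / (4 * (D * vB + 1)) * (D * vB) :=
          mul_le_mul_of_nonneg_right h1 (by positivity)
      _ = κ₂ * vb / 4 * (D * vB / (D * vB + 1)) := by field_simp
      _ ≤ κ₂ * vb / 4 * 1 := by gcongr; rw [div_le_one (by positivity)]; linarith
      _ = κ₂ * vb / 4 := mul_one _
  clear_value δ
  have hsδ : √(√(δ ^ 2)) = √δ := by rw [Real.sqrt_sq hδ0.le]
  -- choice of `ε`
  obtain ⟨ε₁, hε₁, hε₁b⟩ := exists_volume_annulus_le K c R₁ (τ := κ₂ * vb / (4 * (4 * M * A + 1)))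
    (by positivity)
  set ε : ℝ := min ε₁ (r₂ / 6) with hεdef
  have hε : 0 < ε := by positivity
  have hεε₁ : ε ≤ ε₁ := min_le_left _ _
  have hεr₂ : ε ≤ r₂ / 6 := min_le_right _ _
  clear_value ε
  have hεS : 4 * M * A * (volume {y : EuclideanSpace ℝ (Fin 3) |
      dist y c ≤ R₁ ∧ 0 < infDist y K ∧ infDist y K < 4 * ε}).toReal ≤ κ₂ * vb / 4 := by
    have h1 := hε₁b ε hε hεε₁
    calc 4 * M * A * (volume {y : EuclideanSpace ℝ (Fin 3) |
          dist y c ≤ R₁ ∧ 0 < infDist y K ∧ infDist y K < 4 * ε}).toReal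
        ≤ 4 * M * A * (κ₂ * vb / (4 * (4 * M * A + 1))) := by gcongr
      _ = κ₂ * vb / 4 * (4 * M * A / (4 * M * A + 1)) := by field_simp
      _ ≤ κ₂ * vb / 4 * 1 := by
          gcongr; rw [div_le_one (by positivity)]; linarith
      _ = κ₂ * vb / 4 := mul_one _
  -- the cutoff at scale `ε`
  obtain ⟨η, hη1, hη01, hηsupp, hηone, hηD, hηD0⟩ := hcut ε hε
  have hηball : ∀ y, dist y y₀ < r → η y = 1 := by
    intro y hy
    refine hηone y fun k hk => ?_
    have := (hball y hy).2.2 k hk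
    linarith
  have hηK : ∀ y, V y = 0 → dist y c ≤ R₁ → η y = 0 := by
    intro y hVy hyc
    by_contra hne'
    have := hηsupp y hne' y ⟨hVy, hyc⟩
    rw [dist_self] at this
    linarith
  -- the test function `ψ = ĝ η` and the field `G₂`
  set ψ : EuclideanSpace ℝ (Fin 3) → ℝ := fun y => g y * η y with hψdef
  have hψ1 : ContDiff ℝ 1 ψ := hg1.mul hη1
  have hψc : HasCompactSupport ψ := hgc.mul_right
  have hψU : tsupport ψ ⊆ {y | V y ≠ 0} := by
    intro y hy hVy
    have hyg : y ∈ tsupport g := tsupport_mul_subset_left hy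
    have hyη : y ∈ tsupport η := tsupport_mul_subset_right hy
    have hyc : dist y c ≤ R₁ := by
      rw [hgdef, bg.tsupport_eq] at hyg
      exact mem_closedBall.1 hyg
    have hyK : y ∈ K := ⟨hVy, hyc⟩
    have hopen : IsOpen {z : EuclideanSpace ℝ (Fin 3) | dist z y < 3 * ε / 4} :=
      isOpen_lt (continuous_id.dist continuous_const) continuous_const
    have : y ∉ tsupport η := by
      rw [notMem_tsupport_iff_eventuallyEq]
      filter_upwards [hopen.mem_nhds (show dist y y < 3 * ε / 4 by rw [dist_self]; positivity)]
        with z hz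
      by_contra hz'
      have := hηsupp z hz' y hyK
      linarith
    exact this hyη
  set G : EuclideanSpace ℝ (Fin 3) → EuclideanSpace ℝ (Fin 3) :=
    fun z => √(√(lam z ^ 2 + δ ^ 2)) • V z with hGdef
  have hGU : ∀ y ∈ {y | V y ≠ 0}, ContDiffAt ℝ 1 G y := fun y hy =>
    contDiffAt_fieldTwo hδ0.ne' (hlamU y hy) hV1.contDiffAt
  have hGA : ∀ y, dist y c ≤ R₁ → 0 < infDist y K → ‖G y‖ ≤ A * infDist y K := by
    intro y hy hpos
    obtain ⟨h1, h2⟩ := hLin y hy hpos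
    by_cases hVy : V y = 0
    · have : G y = 0 := by simp [hGdef, hVy]
      rw [this, norm_zero]; exact mul_nonneg hA0 infDist_nonneg
    have h3 := norm_sqrt_sqrt_sq_add_smul_le hδ0.le (lam y) (V y)
    rw [← hcurlU y hVy] at h3
    have h4 : √(‖curl W y‖ * ‖V y‖) ≤ L * infDist y K := by
      calc √(‖curl W y‖ * ‖V y‖) ≤ √(L * infDist y K * (L * infDist y K)) :=
            Real.sqrt_le_sqrt (mul_le_mul h1 h2 (norm_nonneg _) (mul_nonneg hL0 infDist_nonneg))
        _ = L * infDist y K := Real.sqrt_mul_self (mul_nonneg hL0 infDist_nonneg)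
    have h5 : √δ ≤ 1 := by rw [Real.sqrt_le_one]; exact hδ1
    calc ‖G y‖ ≤ √(‖curl W y‖ * ‖V y‖) + √δ * ‖V y‖ := h3
      _ ≤ L * infDist y K + 1 * (L * infDist y K) := by gcongr
      _ = A * infDist y K := by rw [hAdef]; ring
  -- the minorant `B = f₁ - f₂ - f₃`
  set S : Set (EuclideanSpace ℝ (Fin 3)) :=
    {y | dist y c ≤ R₁ ∧ 0 < infDist y K ∧ infDist y K < 4 * ε} with hSdef
  have hSm : MeasurableSet S := measurableSet_annulus K c R₁ ε
  set f₁ : EuclideanSpace ℝ (Fin 3) → ℝ := fun y =>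
    κ₂ * (ball y₀ r).indicator (fun _ => (1 : ℝ)) y with hf₁
  set f₂ : EuclideanSpace ℝ (Fin 3) → ℝ := fun y => S.indicator (fun _ => 4 * M * A) y with hf₂
  set f₃ : EuclideanSpace ℝ (Fin 3) → ℝ := fun y =>
    √δ * D * (closedBall c R₁).indicator (fun _ => (1 : ℝ)) y with hf₃
  set B : EuclideanSpace ℝ (Fin 3) → ℝ := fun y => f₁ y - f₂ y - f₃ y with hBdef
  have hI1 : Integrable ((ball y₀ r).indicator fun _ => (1 : ℝ)) volume :=
    (integrableOn_const (hs := measure_ball_lt_top.ne)).integrable_indicator measurableSet_ball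
  have hI2 : Integrable f₂ volume :=
    (integrableOn_const (hs := (volume_annulus_lt_top K c R₁ ε).ne)).integrable_indicator hSm
  have hI3 : Integrable ((closedBall c R₁).indicator fun _ => (1 : ℝ)) volume :=
    (integrableOn_const (hs := measure_closedBall_lt_top.ne)).integrable_indicator
      measurableSet_closedBall
  have hJ1 : Integrable f₁ volume := hI1.const_mul _
  have hJ3 : Integrable f₃ volume := hI3.const_mul _
  have hJ12 : Integrable (fun y => f₁ y - f₂ y) volume := hJ1.sub hI2
  have hBint : Integrable B volume := hJ12.sub hJ3
  have hBval : ∫ y, B y = κ₂ * vb - 4 * M * A * (volume S).toReal - √δ * D * vB := by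
    have e1 : ∫ y, (f₁ y - f₂ y) - f₃ y = (∫ y, f₁ y - f₂ y) - ∫ y, f₃ y := integral_sub hJ12 hJ3
    have e2 : ∫ y, f₁ y - f₂ y = (∫ y, f₁ y) - ∫ y, f₂ y := integral_sub hJ1 hI2
    have e3 : ∫ y, f₁ y = κ₂ * vb := by
      rw [hf₁, integral_const_mul, integral_indicator_const _ measurableSet_ball, hvb,
        measureReal_def, smul_eq_mul, mul_one]
    have e4 : ∫ y, f₂ y = 4 * M * A * (volume S).toReal := by
      rw [hf₂, integral_indicator_const _ hSm, measureReal_def, smul_eq_mul, mul_comm]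
    have e5 : ∫ y, f₃ y = √δ * D * vB := by
      rw [hf₃, integral_const_mul, integral_indicator_const _ measurableSet_closedBall, hvB,
        measureReal_def, smul_eq_mul, mul_one]
    rw [hBdef]
    show ∫ y, (f₁ y - f₂ y) - f₃ y = _
    rw [e1, e2, e3, e4, e5]
  have hf₂0 : ∀ y, 0 ≤ f₂ y := fun y => by
    rw [hf₂]; exact Set.indicator_nonneg (fun _ _ => by positivity) y
  have hind1 : ∀ y, 0 ≤ (ball y₀ r).indicator (fun _ => (1 : ℝ)) y := fun y =>
    Set.indicator_nonneg (fun _ _ => zero_le_one) y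
  have hind3 : ∀ y, 0 ≤ (closedBall c R₁).indicator (fun _ => (1 : ℝ)) y := fun y =>
    Set.indicator_nonneg (fun _ _ => zero_le_one) y
  have hf₃0 : ∀ y, 0 ≤ f₃ y := fun y => by rw [hf₃]; exact mul_nonneg (by positivity) (hind3 y)
  -- pointwise comparison `B ≤ F`
  have hFB : ∀ y, B y ≤ fderiv ℝ ψ y (G y) + ψ y * VectorCalculus.divergence G y := by
    intro y
    have hψD : fderiv ℝ ψ y = g y • fderiv ℝ η y + η y • fderiv ℝ g y :=
      fderiv_fun_mul (hg1.differentiable one_ne_zero y) (hη1.differentiable one_ne_zero y)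
    have hb : -f₂ y ≤ g y * fderiv ℝ η y (G y) := by
      have := norm_mul_fderiv_apply_le_indicator (G := G) hε hM0 hA0
        (fun z => by rw [abs_of_nonneg (hg01 z).1]; exact (hg01 z).2) hgR hGA hηD hηD0 y
      rw [Real.norm_eq_abs] at this
      have := neg_abs_le (g y * fderiv ℝ η y (G y))
      linarith only [this, ‹|g y * (fderiv ℝ η y) (G y)| ≤ _›]
    by_cases hVy : V y = 0
    · -- off `U`: everything vanishes
      have hGy : G y = 0 := by simp [hGdef, hVy]
      have hψy : ψ y = 0 := by
        by_cases hyc : dist y c ≤ R₁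
        · simp [hψdef, hηK y hVy hyc]
        · simp [hψdef, hgR y (not_le.1 hyc)]
      have hnball : y ∉ ball y₀ r := fun hy => hballV y (mem_ball.1 hy) hVy
      have hf₁y : f₁ y = 0 := by rw [hf₁]; dsimp only; rw [Set.indicator_of_notMem hnball, mul_zero]
      rw [hGy, hψy, map_zero, zero_mul, add_zero, hBdef]
      dsimp only
      rw [hf₁y, zero_sub]
      linarith only [hf₂0 y, hf₃0 y]
    -- on `U`
    have hdivge := divergence_fieldTwo_ge (V := V) hδ0.ne'
      ((hlamU y hVy).differentiableAt one_ne_zero) (hV1.differentiable one_ne_zero y) (hdivV y)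
      (htrU y hVy)
    have hs2pos : 0 < √(√(lam y ^ 2 + δ ^ 2)) := sqrt_sqrt_sq_add_pos hδ0.ne' (lam y)
    have hdiv0 : 0 ≤ VectorCalculus.divergence G y := by
      have : 0 ≤ 3 / 4 * √(√(lam y ^ 2 + δ ^ 2)) := by positivity
      exact this.trans hdivge
    -- term (c): `ψ div G ≥ f₁`
    have hc : f₁ y ≤ ψ y * VectorCalculus.divergence G y := by
      rw [hf₁]; dsimp only
      by_cases hyb : y ∈ ball y₀ r
      · obtain ⟨hmle, hyRg, -⟩ := hball y (mem_ball.1 hyb)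
        rw [Set.indicator_of_mem hyb, mul_one]
        have hψy : ψ y = 1 := by
          simp only [hψdef, hgone y hyRg.le, hηball y (mem_ball.1 hyb), mul_one]
        rw [hψy, one_mul]
        refine le_trans ?_ hdivge
        rw [hκ₂]
        have : √m ≤ √(√(lam y ^ 2 + δ ^ 2)) :=
          (Real.sqrt_le_sqrt hmle).trans (sqrt_abs_le_sqrt_sqrt_sq_add δ (lam y))
        linarith only [this]
      · rw [Set.indicator_of_notMem hyb, mul_zero]
        exact mul_nonneg (mul_nonneg (hg01 y).1 (hη01 y).1) hdiv0
    -- term (a): the outer term, `≥ -f₃`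
    have ha : -f₃ y ≤ η y * fderiv ℝ g y (G y) := by
      rw [hf₃]; dsimp only
      by_cases hyc : dist y c ≤ R₁
      · rw [Set.indicator_of_mem (mem_closedBall.2 hyc), mul_one]
        by_cases hyRg : dist y c < Rg
        · rw [hgD0 y hyRg]
          simp only [_root_.zero_apply, mul_zero]
          have : 0 ≤ √δ * D := by positivity
          linarith only [this]
        · -- in the shell: `lam y = 0`, so `G y = √δ • V y`
          have hlam0 : lam y = 0 := hfarlam y (by rw [hRg] at hyRg; linarith only [not_lt.1 hyRg])
          have hGy : G y = √δ • V y := by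
            simp only [hGdef, hlam0]
            rw [zero_pow two_ne_zero, zero_add, hsδ]
          rw [hGy, map_smul, smul_eq_mul]
          have hbd : |η y * (√δ * fderiv ℝ g y (V y))| ≤ √δ * D := by
            rw [abs_mul, abs_mul, abs_of_nonneg (hη01 y).1, abs_of_nonneg (Real.sqrt_nonneg _)]
            have h1 : |fderiv ℝ g y (V y)| ≤ Cg * CV := by
              rw [← Real.norm_eq_abs]
              refine (ContinuousLinearMap.le_opNorm _ _).trans ?_
              exact mul_le_mul (hCg y) (hCV y (mem_closedBall.2 hyc)) (norm_nonneg _) hCg0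
            rw [hDdef]
            calc η y * (√δ * |fderiv ℝ g y (V y)|) ≤ 1 * (√δ * (Cg * CV)) := by
                  gcongr
                  · exact (hη01 y).2
              _ = √δ * (Cg * CV) := one_mul _
          have := neg_abs_le (η y * (√δ * fderiv ℝ g y (V y)))
          linarith only [this, hbd]
      · rw [Set.indicator_of_notMem (fun h => hyc (mem_closedBall.1 h)), mul_zero, neg_zero,
          hgD1 y (not_le.1 hyc)]
        simp
    rw [hψD]
    simp only [_root_.add_apply, _root_.smul_apply, smul_eq_mul]
    rw [hBdef]
    dsimp only
    linarith only [ha, hb, hc]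
  -- the divergence identity, integrated against the minorant
  obtain ⟨hFint, hF0⟩ := integral_fderiv_add_mul_divergence (U := {y | V y ≠ 0}) hGU hψ1 hψc hψU
  have hle : ∫ y, B y ≤ ∫ y, (fderiv ℝ ψ y (G y) + ψ y * VectorCalculus.divergence G y) :=
    integral_mono hBint hFint hFB
  rw [hF0, hBval] at hle
  have hkv : 0 < κ₂ * vb := mul_pos hκ₂0 hvb0
  have hδD' : √δ * D * vB ≤ κ₂ * vb / 4 := by rw [mul_assoc]; exact hδD
  linarith only [hle, hεS, hδD', hkv]

end AlignedStratum

end Summit.NavierStokesRegularity.NavierStokesRegularity.Theorems
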